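import Mathlib
import Summits.NavierStokesRegularity.NavierStokesRegularity.Theorems.SubOnsagerCeilingVirtualFloorFaces
import HarnessLib

/-!
# Depth-2 virtual-floor game: the game hypothesis from a GENERAL face certificate (arbitrary differentiable faces)
(helper file for crux stmt-NavierStokesRegularity-27057 `SubOnsagerCeiling.ForwardTailCeilingKP`, `--supports … --as helper`;
LEAD SOC census v10 §H, `Cruxes/ForwardTailCeilingKP/Lines/virtual-floor-game-SPEC.md` v2)

`game_of_polyCert` (p671432) fixed the face shapes (linear facets + cubic floors). The numerics of LEAD g7 (census v10 §H.3)
show that the x₀-cap must be CURVED (concave in x₁, tilted in x₂) and that corner faces couple three or four coordinates, so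
this file states the reduction for an ARBITRARY finite family of faces `g k ≤ 0` on `[0,1]⁴` (coordinates `x 0, x 1, x 2` =
real shells, `x 3` = the floor shell): the user supplies the faces `g k`, their partial derivatives `dg k i`, a CHAIN RULE
for them along right-differentiable curves (`hchain`, mechanical for polynomial faces), continuity, and the real inequalities:
the datum box lies in the region (`hInit`), the region lies in `{x 0, x 1, x 2 < 1}` (`hSafe`), and on every ACTIVE face
(`g k x = 0` inside the region) the face is non-increasing in the floor variable (`dg k 3 x ≤ 0`, so that the one-sided
information `ẏ ≥ …` can be used), strictly inward for the inertial field for every feed `V ∈ [0,1]`, and non-decreasing along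
the rigid damping direction `(x 0, b2·x 1, b2²·x 2, b2³·x 3)` (`hFace`). Conclusion: the depth-2 game hypothesis, verbatim the
`hGame` of `gameBarrier_le_one_of_tail_geom` / `chain_shellBarrier_of_game_geom` at `k = 2` — `game_of_faceCert`.

HONEST FRAMING: an abstract ODE lemma towards a MODEL-lattice rung (crux `ForwardTailCeilingKP`, route SubOnsagerCeiling,
TL-M2Break); it certifies nothing by itself; nothing here bears on Navier–Stokes regularity; 27057 stays OPEN.
[cite: BarbatoMorandinRomito2011, §2 Lemma 2.1 (invariant-region scheme)] [cite: Hartman2002, Ch. III §4 Cor 4.1]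
-/

noncomputable section

-- the sub-problem namespace `NavierStokesRegularity.NavierStokesRegularity` is the tree's layout (D-0017)
set_option linter.dupNamespace false

namespace Summit.NavierStokesRegularity.NavierStokesRegularity.Theorems.VirtualFloor

open Set Filter Topology

set_option maxHeartbeats 400000 in
/-- **The depth-2 game hypothesis from a general face certificate.** Faces `g k : (Fin 4 → ℝ) → ℝ` (`k` in a finite type)
with partial derivatives `dg k i` satisfying the right-sided chain rule `hchain` and continuity `hcont`; region
`Ω = {x : 0 ≤ x i, x 3 ≤ 1, ∀ k, g k x ≤ 0}`. If the datum box `[0,1/10]³ × [0,1]` lies in `Ω` (`hInit`), `Ω ⊂ {x 0, x 1, x 2 < 1}`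
(`hSafe`), and every active face satisfies `dg k 3 x ≤ 0`, the strict INERTIAL inequality
`∑ᵢ dg k i x · Φᵢ(V, x) < 0` for all `V ∈ [0,1]` (with `Φ = (V − p x₀x₁, L(x₀² − p x₁x₂), L²(x₁² − p x₂x₃), L³(x₂² − p x₃))`)
and the DAMPING sign condition `0 ≤ ∑ᵢ dg k i x · b2ⁱ xᵢ` (`hFace`), then every play of the depth-2 rigid-damping virtual-floor
game with constants `(L, p, b2)` and datum `1/10` keeps its real shells `< 1`.
[cite: BarbatoMorandinRomito2011, §2 Lemma 2.1 (first-exit scheme)] -/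
theorem game_of_faceCert {ι : Type*} [Finite ι] {L p b2 : ℝ}
    {g : ι → (Fin 4 → ℝ) → ℝ} {dg : ι → Fin 4 → (Fin 4 → ℝ) → ℝ}
    (hcont : ∀ k, Continuous (g k))
    (hchain : ∀ k (X : ℝ → Fin 4 → ℝ) (X' : Fin 4 → ℝ) (t : ℝ),
      (∀ i, HasDerivWithinAt (fun s => X s i) (X' i) (Ici t) t) →
      HasDerivWithinAt (fun s => g k (X s)) (∑ i, dg k i (X t) * X' i) (Ici t) t)
    (hInit : ∀ x : Fin 4 → ℝ, 0 ≤ x 0 → x 0 ≤ 1 / 10 → 0 ≤ x 1 → x 1 ≤ 1 / 10 → 0 ≤ x 2 → x 2 ≤ 1 / 10 →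
      0 ≤ x 3 → x 3 ≤ 1 → ∀ k, g k x ≤ 0)
    (hSafe : ∀ x : Fin 4 → ℝ, (∀ i, 0 ≤ x i) → x 3 ≤ 1 → (∀ k, g k x ≤ 0) → x 0 < 1 ∧ x 1 < 1 ∧ x 2 < 1)
    (hFace : ∀ k (x : Fin 4 → ℝ), (∀ i, 0 ≤ x i) → x 3 ≤ 1 → (∀ k', g k' x ≤ 0) → g k x = 0 →
      dg k 3 x ≤ 0 ∧
      (∀ V : ℝ, 0 ≤ V → V ≤ 1 →
        dg k 0 x * (V - p * x 0 * x 1) + dg k 1 x * (L * (x 0 ^ 2 - p * x 1 * x 2)) +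
          dg k 2 x * (L ^ 2 * (x 1 ^ 2 - p * x 2 * x 3)) + dg k 3 x * (L ^ 3 * (x 2 ^ 2 - p * x 3)) < 0) ∧
      0 ≤ dg k 0 x * x 0 + dg k 1 x * (b2 * x 1) + dg k 2 x * (b2 ^ 2 * x 2) + dg k 3 x * (b2 ^ 3 * x 3)) :
    ∀ (Fr T : ℝ), 0 < Fr → 0 < T →
      ∀ (S : ℕ → ℝ → ℝ) (d : ℝ) (v y : ℝ → ℝ),
      (∀ i, i ≤ 2 → ContinuousOn (S i) (Icc 0 T)) → ContinuousOn y (Icc 0 T) →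
      (∀ i, i ≤ 2 → ∀ t ∈ Ico 0 T, HasDerivWithinAt (S i)
        (-(d * b2 ^ i) * S i t + Fr * L ^ i * ((if i = 0 then v t else S (i - 1) t) ^ 2 -
          p * S i t * (if i = 2 then y t else S (i + 1) t))) (Ici t) t) →
      (∀ t ∈ Ico 0 T, ∃ y' : ℝ, HasDerivWithinAt y y' (Ici t) t ∧
        -(d * b2 ^ (2 + 1)) * y t + Fr * L ^ (2 + 1) * (S 2 t ^ 2 - p * y t) ≤ y') →
      0 ≤ d →
      (∀ t ∈ Icc 0 T, 0 ≤ v t ∧ v t ≤ 1) → (∀ t ∈ Icc 0 T, 0 ≤ y t ∧ y t ≤ 1) →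
      (∀ i, i ≤ 2 → ∀ t ∈ Icc 0 T, 0 ≤ S i t) → (∀ i, i ≤ 2 → S i 0 ≤ 1 / 10) →
      ∀ i, i ≤ 2 → ∀ t ∈ Icc 0 T, S i t < 1 := by
  intro Fr T hFr hT S d v y hSc hyc hSd hyd hd hv hy hS0 hSinit
  classical
  -- the exact derivatives of the three real shells
  set D0 : ℝ → ℝ := fun t => -(d * b2 ^ 0) * S 0 t + Fr * L ^ 0 * (v t ^ 2 - p * S 0 t * S 1 t) with hD0
  set D1 : ℝ → ℝ := fun t => -(d * b2 ^ 1) * S 1 t + Fr * L ^ 1 * (S 0 t ^ 2 - p * S 1 t * S 2 t) with hD1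
  set D2 : ℝ → ℝ := fun t => -(d * b2 ^ 2) * S 2 t + Fr * L ^ 2 * (S 1 t ^ 2 - p * S 2 t * y t) with hD2
  set Dy : ℝ → ℝ := fun t => -(d * b2 ^ (2 + 1)) * y t + Fr * L ^ (2 + 1) * (S 2 t ^ 2 - p * y t) with hDy
  have hd0 : ∀ t ∈ Ico 0 T, HasDerivWithinAt (S 0) (D0 t) (Ici t) t := by
    intro t ht; simpa [hD0] using hSd 0 (by norm_num) t ht
  have hd1 : ∀ t ∈ Ico 0 T, HasDerivWithinAt (S 1) (D1 t) (Ici t) t := by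
    intro t ht; simpa [hD1] using hSd 1 (by norm_num) t ht
  have hd2 : ∀ t ∈ Ico 0 T, HasDerivWithinAt (S 2) (D2 t) (Ici t) t := by
    intro t ht; simpa [hD2] using hSd 2 (by norm_num) t ht
  -- a chosen right derivative of `y`, bounded below by `Dy`
  have hych : ∀ t, ∃ y' : ℝ, (t ∈ Ico 0 T → HasDerivWithinAt y y' (Ici t) t ∧ Dy t ≤ y') := by
    intro t
    by_cases ht : t ∈ Ico 0 T
    · obtain ⟨y', hy', hlo⟩ := hyd t ht
      exact ⟨y', fun _ => ⟨hy', by simpa [hDy] using hlo⟩⟩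
    · exact ⟨0, fun h => absurd h ht⟩
  choose Y' hY' using hych
  -- the play as a curve in `Fin 4 → ℝ`
  set X : ℝ → Fin 4 → ℝ := fun t => ![S 0 t, S 1 t, S 2 t, y t] with hX
  set X' : ℝ → Fin 4 → ℝ := fun t => ![D0 t, D1 t, D2 t, Y' t] with hX'
  have hX0 : ∀ t, X t 0 = S 0 t := fun t => rfl
  have hX1 : ∀ t, X t 1 = S 1 t := fun t => rfl
  have hX2 : ∀ t, X t 2 = S 2 t := fun t => rfl
  have hX3 : ∀ t, X t 3 = y t := fun t => rfl
  have hXd : ∀ t ∈ Ico 0 T, ∀ i, HasDerivWithinAt (fun s => X s i) (X' t i) (Ici t) t := by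
    intro t ht i
    fin_cases i
    · exact hd0 t ht
    · exact hd1 t ht
    · exact hd2 t ht
    · exact (hY' t ht).1
  -- the faces along the play
  set h : ι → ℝ → ℝ := fun k t => g k (X t) with hh
  set h' : ι → ℝ → ℝ := fun k t => ∑ i, dg k i (X t) * X' t i with hh'
  have hc0 := hSc 0 (by norm_num)
  have hc1 := hSc 1 (by norm_num)
  have hc2 := hSc 2 (by norm_num)
  have hXc : ContinuousOn X (Icc 0 T) := by
    refine continuousOn_pi.2 fun i => ?_
    fin_cases i
    · exact hc0
    · exact hc1
    · exact hc2
    · exact hyc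
  have hhcont : ∀ k, ContinuousOn (h k) (Icc 0 T) := fun k => (hcont k).comp_continuousOn hXc
  have hder : ∀ k, ∀ t ∈ Ico 0 T, HasDerivWithinAt (h k) (h' k t) (Ici t) t :=
    fun k t ht => hchain k X (X' t) t (hXd t ht)
  -- region facts along the play
  have hnn : ∀ t ∈ Icc 0 T, ∀ i, 0 ≤ X t i := by
    intro t ht i
    fin_cases i
    · exact hS0 0 (by norm_num) t ht
    · exact hS0 1 (by norm_num) t ht
    · exact hS0 2 (by norm_num) t ht
    · exact (hy t ht).1
  -- the strict active-face condition
  have hface : ∀ t ∈ Ico 0 T, (∀ j, h j t ≤ 0) → ∀ k, h k t = 0 → h' k t < 0 := by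
    intro t ht hall k hk
    have htI : t ∈ Icc 0 T := Ico_subset_Icc_self ht
    obtain ⟨hy0, hy1⟩ := hy t htI
    obtain ⟨hv0, hv1⟩ := hv t htI
    have hV0 : 0 ≤ v t ^ 2 := sq_nonneg _
    have hV1 : v t ^ 2 ≤ 1 := by nlinarith
    obtain ⟨hm, hQ, hSt⟩ := hFace k (X t) (hnn t htI) (by rw [hX3]; exact hy1) hall hk
    have hQV := hQ (v t ^ 2) hV0 hV1
    rw [hX0, hX1, hX2, hX3] at hQV hSt
    change ∑ i, dg k i (X t) * X' t i < 0
    rw [Fin.sum_univ_four]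
    change dg k 0 (X t) * D0 t + dg k 1 (X t) * D1 t + dg k 2 (X t) * D2 t + dg k 3 (X t) * Y' t < 0
    have hylo : Dy t ≤ Y' t := (hY' t ht).2
    have h3 : dg k 3 (X t) * Y' t ≤ dg k 3 (X t) * Dy t := mul_le_mul_of_nonpos_left hylo hm
    have key : dg k 0 (X t) * D0 t + dg k 1 (X t) * D1 t + dg k 2 (X t) * D2 t + dg k 3 (X t) * Dy t =
        Fr * (dg k 0 (X t) * (v t ^ 2 - p * S 0 t * S 1 t) + dg k 1 (X t) * (L * (S 0 t ^ 2 - p * S 1 t * S 2 t)) +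
          dg k 2 (X t) * (L ^ 2 * (S 1 t ^ 2 - p * S 2 t * y t)) + dg k 3 (X t) * (L ^ 3 * (S 2 t ^ 2 - p * y t))) -
        d * (dg k 0 (X t) * S 0 t + dg k 1 (X t) * (b2 * S 1 t) + dg k 2 (X t) * (b2 ^ 2 * S 2 t) +
          dg k 3 (X t) * (b2 ^ 3 * y t)) := by
      simp only [hD0, hD1, hD2, hDy]; ring
    have hneg := mul_neg_of_pos_of_neg hFr hQV
    have hdmp := mul_nonneg hd hSt
    linarith
  -- the faces hold initially
  have h0 : ∀ k, h k 0 ≤ 0 := by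
    have hT0 : (0 : ℝ) ∈ Icc 0 T := ⟨le_rfl, hT.le⟩
    obtain ⟨hy0, hy1⟩ := hy 0 hT0
    intro k
    exact hInit (X 0) (hS0 0 (by norm_num) 0 hT0) (hSinit 0 (by norm_num)) (hS0 1 (by norm_num) 0 hT0)
      (hSinit 1 (by norm_num)) (hS0 2 (by norm_num) 0 hT0) (hSinit 2 (by norm_num)) hy0 hy1 k
  -- first exit
  have hall := forall_le_of_hasDerivWithinAt_Ici_of_active_lt (c := fun _ => (0 : ℝ)) hhcont hder hface h0
  intro i hi t ht
  obtain ⟨h0lt, h1lt, h2lt⟩ := hSafe (X t) (hnn t ht) (by rw [hX3]; exact (hy t ht).2) (hall t ht)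
  interval_cases i
  · exact h0lt
  · exact h1lt
  · exact h2lt

end Summit.NavierStokesRegularity.NavierStokesRegularity.Theorems.VirtualFloor

end
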